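import Mathlib
import Literature.Computability.AlgebraicComplexity.AutomatonIMM

/-!
# ValiantsHypothesis / PartialSorting — `BoundedWidthInVP`, part 1: the cut-width automaton

Route `PartialSorting`, item `stmt-ValiantsHypothesis-13595` (support): for every constant `c`,
the width-`c` truncated determinant family
`(∑_{σ ∈ S_n : #{a ≤ t : σ(a) > t} ≤ c ∀ t} sgn σ · ∏_a x_{a σ(a)})_n` is a `VP` family over `ℂ`.
This file builds the transfer-matrix dynamic programme as a *layered automaton* in the sense of
`Literature/Computability/AlgebraicComplexity/AutomatonIMM.lean` and analyses its runs; the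
sequel `PartialSortingBoundedWidthInVP.lean` identifies its word polynomial with the truncated
determinant and derives the `VP` bound.

* States after `t` letters (`St n c t`): the *admissible* used-value sets `A ⊆ Fin n`,
  `#A = t` and `#(A ∩ [t, n)) ≤ c` (the cut condition at `t - 1`); they are coded injectively
  into `Fin (((n+1)^c)^2)` by the sorted `c`-tuples of `A ∩ [t,n)` and `[0,t) ∖ A`
  (`enc`, `enc_injective`).
* Letters (`Letter n = Fin n × Bool`): a value and a parity bit; the transition `step` at layer
  `t` accepts `(v, b)` from `A` iff `v ∉ A`, `insert v A` is admissible at `t + 1`, and `b` is the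
  parity of `#{u ∈ A : u > v}` (the new inversions).
* `accepts_iff_good`: a word is accepted iff it is `Good` — distinct values, admissible prefix
  images, correct parity bits (`exists_run_eq_some_of_good`, `good_of_run_eq_some`).

## References

* A. Björner, F. Brenti, *Combinatorics of Coxeter Groups*, GTM 231, Springer 2005, §2.1
  (rank / cut criteria for Bruhat order; the cut width `#{a ≤ t : σ(a) > t}`).
* N. Limaye, S. Srinivasan, S. Tavenas, J. ACM 72 (2025), Art. 26, Lemma 8 / Lemma 22
  (layered automata are projections of `IMM`).
-/

-- The sub-problem of the single-problem summit `ValiantsHypothesis` is `ValiantsHypothesis`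
-- (Sub = Summit), so the duplicated namespace component `…ValiantsHypothesis.ValiantsHypothesis…`
-- is the tree's convention; silence the corresponding linter for this file.
set_option linter.dupNamespace false

noncomputable section

open Literature.Computability.AlgebraicComplexity

namespace Summit.ValiantsHypothesis.ValiantsHypothesis.Theorems.PartialSortingBoundedWidth

open scoped Classical

/-! ### Codes of small subsets of `Fin n` -/

section Codes

variable {n : ℕ}

/-- The code of a finset `A ⊆ Fin n` as a `c`-tuple of options: the `i`-th entry of the
increasingly sorted list of `A` (`none` beyond its length). Injective on sets of size `≤ c`.
[folklore] -/
def code (c : ℕ) (A : Finset (Fin n)) : Fin c → Option (Fin n) :=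
  fun i => (A.sort (· ≤ ·))[(i : ℕ)]?

/-- Membership is read off the code when `#A ≤ c`. [folklore] -/
theorem mem_iff_exists_code_eq {c : ℕ} {A : Finset (Fin n)} (hA : A.card ≤ c) (x : Fin n) :
    x ∈ A ↔ ∃ i : Fin c, code c A i = some x := by
  rw [← Finset.mem_sort (· ≤ ·), List.mem_iff_getElem?]
  constructor
  · rintro ⟨i, hi⟩
    have hlt : i < (A.sort (· ≤ ·)).length := (List.getElem?_eq_some_iff.mp hi).1
    rw [Finset.length_sort] at hlt
    exact ⟨⟨i, lt_of_lt_of_le hlt hA⟩, hi⟩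
  · rintro ⟨i, hi⟩
    exact ⟨i, hi⟩

/-- The code is injective on sets of size `≤ c`. [folklore] -/
theorem eq_of_code_eq {c : ℕ} {A B : Finset (Fin n)} (hA : A.card ≤ c) (hB : B.card ≤ c)
    (h : code c A = code c B) : A = B := by
  ext x
  rw [mem_iff_exists_code_eq hA, mem_iff_exists_code_eq hB, h]

/-- The number of pairs of codes is `((n+1)^c)^2`. [folklore] -/
theorem card_codePair (n c : ℕ) :
    Fintype.card ((Fin c → Option (Fin n)) × (Fin c → Option (Fin n))) = ((n + 1) ^ c) ^ 2 := by
  simp only [Fintype.card_prod, Fintype.card_fun, Fintype.card_option, Fintype.card_fin]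
  ring

end Codes

/-! ### The automaton of the cut-width dynamic programme -/

section Automaton

variable (n c : ℕ)

/-- Admissible states after `t` letters: used-value sets `A` with `#A = t` and at most `c`
used values `≥ t` (the cut condition at `t - 1`). [folklore] -/
abbrev Adm (t : ℕ) (A : Finset (Fin n)) : Prop :=
  A.card = t ∧ (A.filter fun u : Fin n => t ≤ (u : ℕ)).card ≤ c

/-- The state type at layer `t`. [folklore] -/
abbrev St (t : ℕ) : Type := {A : Finset (Fin n) // Adm n c t A}

/-- The start state: no value used. [folklore] -/
def start : St n c 0 := ⟨∅, Finset.card_empty, by simp⟩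

variable {n} in
/-- The number of elements of `A` above `v` (the new inversions created by placing `v`).
[folklore] -/
def cnt (A : Finset (Fin n)) (v : Fin n) : ℕ := (A.filter fun u : Fin n => v < u).card

/-- Letters: a value and a parity bit. [folklore] -/
abbrev Letter : Type := Fin n × Bool

/-- The transition at layer `t`: the value must be fresh, the new state admissible, and the bit
must be the parity of the number of new inversions. [folklore] -/
def step (t : Fin n) (s : St n c t) (b : Letter n) : Option (St n c (t.val + 1)) :=
  if h : b.1 ∉ s.1 ∧ Adm n c (t.val + 1) (insert b.1 s.1) ∧ b.2 = decide (Odd (cnt s.1 b.1)) then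
    some ⟨insert b.1 s.1, h.2.1⟩
  else none

/-- The number of matrix states: `((n+1)^c)^2`. [folklore] -/
def nSt : ℕ := ((n + 1) ^ c) ^ 2

/-- The initial segment `{u : u < t}` of `Fin n`. [folklore] -/
def seg (t : ℕ) : Finset (Fin n) := Finset.univ.filter fun u : Fin n => (u : ℕ) < t

/-- The state encoding: the codes of `A ∩ [t, n)` and of `[0, t) ∖ A`. [folklore] -/
def enc (t : ℕ) (s : St n c t) : Fin (nSt n c) :=
  Fintype.equivFinOfCardEq (card_codePair n c)
    (code c (s.1.filter fun u : Fin n => t ≤ (u : ℕ)), code c (seg n t \ s.1))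

variable {n c}

/-- `#(seg t) = t` for `t ≤ n`. [folklore] -/
theorem card_seg {t : ℕ} (ht : t ≤ n) : (seg n t).card = t := by
  unfold seg
  rw [Fin.card_filter_val_lt, min_eq_right ht]

/-- For an admissible state, the unused values below `t` are at most `c`. [folklore] -/
theorem card_seg_sdiff_le {t : ℕ} (ht : t ≤ n) (s : St n c t) : (seg n t \ s.1).card ≤ c := by
  obtain ⟨A, hcard, hfil⟩ := s
  have h1 := Finset.card_sdiff_add_card_inter (seg n t) A
  have h2 := Finset.card_sdiff_add_card_inter A (seg n t)
  have h3 : A \ seg n t = A.filter fun u : Fin n => t ≤ (u : ℕ) := by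
    ext u
    simp only [Finset.mem_sdiff, seg, Finset.mem_filter, Finset.mem_univ, true_and, not_lt]
  rw [card_seg ht, Finset.inter_comm] at h1
  rw [hcard, h3] at h2
  dsimp only
  omega

/-- The state encoding is injective (up to layer `n`). [folklore] -/
theorem enc_injective (t : ℕ) (ht : t ≤ n) : Function.Injective (enc n c t) := by
  intro A B h
  have h' := (Fintype.equivFinOfCardEq (card_codePair n c)).injective h
  simp only [Prod.mk.injEq] at h'
  have eU := eq_of_code_eq A.2.2 B.2.2 h'.1
  have eM := eq_of_code_eq (card_seg_sdiff_le ht A) (card_seg_sdiff_le ht B) h'.2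
  apply Subtype.ext
  ext x
  by_cases hx : (x : ℕ) < t
  · have hxs : x ∈ seg n t := by simpa [seg] using hx
    have hA : x ∈ A.1 ↔ x ∉ seg n t \ A.1 := by simp [Finset.mem_sdiff, hxs]
    have hB : x ∈ B.1 ↔ x ∉ seg n t \ B.1 := by simp [Finset.mem_sdiff, hxs]
    rw [hA, hB, eM]
  · rw [not_lt] at hx
    have hA : x ∈ A.1 ↔ x ∈ A.1.filter fun u : Fin n => t ≤ (u : ℕ) := by simp [hx]
    have hB : x ∈ B.1 ↔ x ∈ B.1.filter fun u : Fin n => t ≤ (u : ℕ) := by simp [hx]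
    rw [hA, hB, eU]

/-! ### Runs of the automaton -/

/-- The image of the first `t` positions under `v`. [folklore] -/
def img (v : Fin n → Fin n) (t : ℕ) : Finset (Fin n) := (seg n t).image v

/-- `img v 0 = ∅`. [folklore] -/
theorem img_zero (v : Fin n → Fin n) : img v 0 = ∅ := by
  simp [img, seg]

/-- `img v (t+1) = insert (v t) (img v t)`. [folklore] -/
theorem img_succ (v : Fin n → Fin n) {t : ℕ} (ht : t < n) :
    img v (t + 1) = insert (v ⟨t, ht⟩) (img v t) := by
  ext x
  simp only [img, seg, Finset.mem_image, Finset.mem_filter, Finset.mem_univ, true_and,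
    Finset.mem_insert]
  constructor
  · rintro ⟨i, hi, rfl⟩
    rcases Nat.lt_succ_iff_lt_or_eq.mp hi with hi | hi
    · exact Or.inr ⟨i, hi, rfl⟩
    · left
      congr 1
      exact Fin.ext hi
  · rintro (rfl | ⟨i, hi, rfl⟩)
    · exact ⟨⟨t, ht⟩, Nat.lt_succ_self t, rfl⟩
    · exact ⟨i, Nat.lt_succ_of_lt hi, rfl⟩

variable (n c) in
/-- `Good w t`: the first `t` letters of `w` form an accepted run — distinct values, admissible
prefixes, correct parity bits. [folklore] -/
def Good (w : Fin n → Letter n) (t : ℕ) : Prop :=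
  (∀ i j : Fin n, (i : ℕ) < t → (j : ℕ) < t → (w i).1 = (w j).1 → i = j) ∧
  ∀ i : Fin n, (i : ℕ) < t →
    Adm n c ((i : ℕ) + 1) (img (fun j => (w j).1) ((i : ℕ) + 1)) ∧
    (w i).2 = decide (Odd (cnt (img (fun j => (w j).1) i) (w i).1))

/-- One more letter. [folklore] -/
theorem good_succ_iff (w : Fin n → Letter n) {t : ℕ} (ht : t < n) :
    Good n c w (t + 1) ↔ Good n c w t ∧ (w ⟨t, ht⟩).1 ∉ img (fun j => (w j).1) t ∧
      Adm n c (t + 1) (insert (w ⟨t, ht⟩).1 (img (fun j => (w j).1) t)) ∧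
      (w ⟨t, ht⟩).2 = decide (Odd (cnt (img (fun j => (w j).1) t) (w ⟨t, ht⟩).1)) := by
  set v : Fin n → Fin n := fun j => (w j).1 with hv
  rw [← img_succ v ht]
  constructor
  · rintro ⟨hinj, hcl⟩
    refine ⟨⟨fun i j hi hj h => hinj i j (Nat.lt_succ_of_lt hi) (Nat.lt_succ_of_lt hj) h,
      fun i hi => hcl i (Nat.lt_succ_of_lt hi)⟩, ?_, (hcl ⟨t, ht⟩ (Nat.lt_succ_self t)).1,
      (hcl ⟨t, ht⟩ (Nat.lt_succ_self t)).2⟩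
    intro hmem
    simp only [img, seg, Finset.mem_image, Finset.mem_filter, Finset.mem_univ, true_and] at hmem
    obtain ⟨j, hj, hjv⟩ := hmem
    have := hinj j ⟨t, ht⟩ (Nat.lt_succ_of_lt hj) (Nat.lt_succ_self t) hjv
    rw [this] at hj
    exact lt_irrefl t hj
  · rintro ⟨⟨hinj, hcl⟩, hfresh, hadm, hpar⟩
    have key : ∀ j : Fin n, (j : ℕ) < t → (w j).1 = (w ⟨t, ht⟩).1 → False := by
      intro j hj h
      apply hfresh
      simp only [img, seg, Finset.mem_image, Finset.mem_filter, Finset.mem_univ, true_and]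
      exact ⟨j, hj, h⟩
    refine ⟨fun i j hi hj h => ?_, fun i hi => ?_⟩
    · rcases Nat.lt_succ_iff_lt_or_eq.mp hi with hi | hi <;>
        rcases Nat.lt_succ_iff_lt_or_eq.mp hj with hj | hj
      · exact hinj i j hi hj h
      · have hj' : j = ⟨t, ht⟩ := Fin.ext hj
        subst hj'
        exact (key i hi h).elim
      · have hi' : i = ⟨t, ht⟩ := Fin.ext hi
        subst hi'
        exact (key j hj h.symm).elim
      · exact Fin.ext (hi.trans hj.symm)
    · rcases Nat.lt_succ_iff_lt_or_eq.mp hi with hi | hi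
      · exact hcl i hi
      · have hi' : i = ⟨t, ht⟩ := Fin.ext hi
        subst hi'
        exact ⟨hadm, hpar⟩

/-- A good prefix is an accepted run, ending in the state `img v t`. [folklore] -/
theorem exists_run_eq_some_of_good (w : Fin n → Letter n) (t : ℕ) (ht : t ≤ n)
    (hg : Good n c w t) :
    ∃ s : St n c t, LayeredAutomaton.run (St := St n c) (start n c) (step n c) w t = some s ∧
      s.1 = img (fun j => (w j).1) t := by
  induction t with
  | zero => exact ⟨start n c, rfl, by simp [start, img_zero]⟩
  | succ t ih =>
    have ht' : t < n := Nat.lt_of_succ_le ht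
    obtain ⟨hg', hfresh, hadm, hpar⟩ := (good_succ_iff w ht').mp hg
    obtain ⟨s, hs, hs1⟩ := ih ht'.le hg'
    rw [LayeredAutomaton.run_succ (start n c) (step n c) w t ht', hs, Option.bind_some]
    rw [← hs1] at hfresh hadm hpar
    refine ⟨⟨insert (w ⟨t, ht'⟩).1 s.1, hadm⟩, ?_, ?_⟩
    · unfold step
      rw [dif_pos ⟨hfresh, hadm, hpar⟩]
    · show insert _ s.1 = _
      rw [hs1, img_succ _ ht']

/-- An accepted run of length `t` is a good prefix and ends in the state `img v t`. [folklore] -/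
theorem good_of_run_eq_some (w : Fin n → Letter n) (t : ℕ) (ht : t ≤ n) (s : St n c t)
    (hs : LayeredAutomaton.run (St := St n c) (start n c) (step n c) w t = some s) :
    Good n c w t ∧ s.1 = img (fun j => (w j).1) t := by
  induction t with
  | zero =>
    refine ⟨⟨fun i j hi => absurd hi (Nat.not_lt_zero _), fun i hi => absurd hi (Nat.not_lt_zero _)⟩,
      ?_⟩
    have : s = start n c := by
      have h0 : LayeredAutomaton.run (St := St n c) (start n c) (step n c) w 0 = some (start n c) :=
        rfl
      rw [h0] at hs
      exact (Option.some.inj hs).symm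
    rw [this, img_zero]
    rfl
  | succ t ih =>
    have ht' : t < n := Nat.lt_of_succ_le ht
    rw [LayeredAutomaton.run_succ (start n c) (step n c) w t ht'] at hs
    cases hr : LayeredAutomaton.run (St := St n c) (start n c) (step n c) w t with
    | none => rw [hr] at hs; exact absurd hs (by simp)
    | some s₀ =>
      rw [hr, Option.bind_some] at hs
      obtain ⟨hg₀, hs₀⟩ := ih ht'.le s₀ hr
      unfold step at hs
      by_cases hcond : (w ⟨t, ht'⟩).1 ∉ s₀.1 ∧ Adm n c (t + 1) (insert (w ⟨t, ht'⟩).1 s₀.1) ∧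
          (w ⟨t, ht'⟩).2 = decide (Odd (cnt s₀.1 (w ⟨t, ht'⟩).1))
      · rw [dif_pos hcond] at hs
        have hs' := Option.some.inj hs
        rw [hs₀] at hcond
        refine ⟨(good_succ_iff w ht').mpr ⟨hg₀, hcond⟩, ?_⟩
        rw [← hs']
        show insert _ s₀.1 = _
        rw [hs₀, img_succ _ ht']
      · rw [dif_neg hcond] at hs
        exact absurd hs (by simp)

/-- **Acceptance = goodness of the whole word.** [folklore] -/
theorem accepts_iff_good (w : Fin n → Letter n) :
    LayeredAutomaton.Accepts (St := St n c) (start n c) (step n c) w ↔ Good n c w n := by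
  rw [LayeredAutomaton.accepts_iff]
  constructor
  · rintro ⟨s, hs⟩
    exact (good_of_run_eq_some w n le_rfl s hs).1
  · intro hg
    obtain ⟨s, hs, -⟩ := exists_run_eq_some_of_good w n le_rfl hg
    exact ⟨s, hs⟩

end Automaton

end Summit.ValiantsHypothesis.ValiantsHypothesis.Theorems.PartialSortingBoundedWidth
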